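import Literature.MathematicalPhysics.QuantumFieldTheory.Balaban1983to89.B11Eq90V0primeBond
import Literature.MathematicalPhysics.QuantumFieldTheory.Balaban1983to89.B11Eq111FrakG

/-!
# `Balaban1983to89.B11Eq90V0primeCurrent` — T. Bałaban, *The variational problem and background fields in renormalization group method for lattice gauge theories*, Commun. Math. Phys. **102** (1985) 277–309 [Balaban1985Variational]: (63) p. 287, (27) p. 282 and (90)/(97)–(98) pp. 291–293 — THE V′₀-GROUP OF `(δ/δA′)V` AS A CONFIGURATION-VALUED MAP ON THE CARRIERS OF (115): the current `b ↦ Σ_{p∈st(b)} ((∂/∂A(b))V′₀)(A, ∂p)` representing the functional derivative of `Σ_p η^d V′₀(A, ∂p)` through the pairing (27), typed `Space115 L η lev₀ lev₁ ∇ → NegSize L η lev₀ 3 𝔸` on the periodic lattice, with its `|·|_{(−3)}` bound of the shape «O(1)ε₃²(ε₁ + ε₃)» (the (90)-leaf `est90` of `B11Prop4Assembly.TermwiseDatum`) and its analyticity (`an₄`) PROVED (the pairing identity (63) is certified in the sequel `B11Eq98V0primeCurrentSlots`)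

statement-level skeleton of published theorems with citation tags; proofs where landed; nothing here is a claim about the Yang–Mills mass gap

PDF held: `paper:balaban1985-cmp102-variational-background` (journal page = PDF page + 276); pp. 282, 286–287, 291–295 read from the `lit read` text
layer; displays as transcribed in `B11Eq27Current` ((27)), `B11Eq63FunctionalDerivative` ((63)), `B11Eq85FirstDerivative` ((90)), `B11Eq115Space` ((115)).

CITATION HEADER (lean-in-tree rule 2026-08-18).  WHAT IS REPRODUCED: the V′₀-group `W₄` of the five termwise groups (85)–(96) of `(δ/δA′)V`
(row `B11.Eq85` of reader r08's `ROWS-B11.md`; `B11Prop4Assembly.TermwiseDatum.W₄`/`est90`/`an₄`), READ AT `A` — i.e. before the composition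
with the Sect. C map (47) `A = A′ − HD(A′)` —, as an OBJECT between the concrete carriers of the pub-balaban NE9 letter map (letter (L3)
`W = (δ/δA′)V : Space115 … → NegSize … 3 V`, INTERFACE REQUEST NE9 HOME/INBOX.md l.11394–11396; W-slot type of
`B11Eq103H1Complex.chartOfLetters` / `B11Eq115Space.chartHB115`).  THE PRINT, verbatim.  p. 282 (27): *«Σ_{p⊂Ω₀} η^{d−2} Im tr(DA)(p)U₀(∂p) =
Σ_{p⊂Ω₀} η^{d−2} tr(DA)(p) Im U₀(∂p) = ⟨A, J⟩»* (the pairing `⟨A, J⟩ = Σ_b η^d tr A(b)J(b)`, `B9Eq39Adjoint.bondPair`); p. 287 (63): *«The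
functional derivative is a kernel of the linear operator acting on functions δA′ and defined as ⟨(δ/δA′)D(A′), δA′⟩ = (d/dτ)D(A′ +
τδA′)|_{τ=0}.»*; p. 291 (90): *«(δ/δA′(b)) V′₀(A′ − HD(A′)) = Σ_{p∈st(b)} ((∂/∂A(b))V′₀)(A′ − HD(A′), ∂p) − 𝔇*(A′)H* Σ_{p∈st(·)} ((∂/∂A(·))V′₀)
(A′ − HD(A′), ∂p), (90) where st(b) denotes a set of plaquettes p such that b ⊂ ∂p. The derivative ((∂/∂A(b))V′₀)(A, ∂p) satisfies a bound
similar to the bound (40) for the function V′₀(A, ∂p), but with the power of |A| lower by 1, and with a different absolute constant. This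
implies that the functional derivative (90) can be estimated by O(1)ε₃²(ε₁ + ε₃)(Lʲη)⁻³ on Ω_j.»*; p. 292 (Prop. 4): *«The functional
derivative of V(A′) is an analytic function on this space, and satisfies the estimate |((δ/δA′)V)(A′)| < C₄ε₃²(Lʲη)⁻³ on Ω_j … The constants
a₃, C₄ depend on d and L only. … |((δ/δA′)V)(A′)|₍₋₃₎ ≦ C₄(max{|A′|₍₋₁₎, |∇A′|₍₋₂₎})², (98)»*.

THE DICTIONARY (bridge between the two carriers of the tree; nothing re-declared).  The periodic lattice of `B9SectCLatticeCarrier`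
(`TSite d Pd`, bonds `Bond d Pd = TSite × Fin d`, `(x, μ) = ⟨x, x + e_μ⟩`) IS [5]'s abstract lattice of `B9Eq39Adjoint` /
`B11Eq26ActionExpansion` at sites `S := TSite d Pd`, directions `ι := Fin d`, shifts `T μ := B9Eq33CovDerivVector.shiftEquiv μ` (`x ↦ x + e_μ`),
background `U μ x := U₀(x, μ)` (`Ucur`), configuration `A μ x := Y(x, μ)` (`curL`, print's «identification A(x, x + ηe_μ) = A_μ(x)», [5] p. 391);
under it r08's covariant curl `curlη` IS the antisymmetrised `B11Eq111FrakG.nabla115` of the (115) carrier (`curlη_curL_eq_nabla115`).  The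
fibre `𝔸 ⊇ 𝔤ᶜ` is the carrier fibre `V := 𝔸` of `B11Eq115Space`; the REPRESENTATION of the `ℂ`-linear one-bond functionals
`ℓ : 𝔸 →L[ℂ] ℂ` by algebra elements is a `ℂ`-LINEAR dualising map `ρ : (𝔸 →L[ℂ] ℂ) →L[ℂ] 𝔸` of the BILINEAR trace pairing of (27),
`τ(ρ(ℓ)·X) = ℓ(X)` (for `𝔤ᶜ ⊆ M_N(ℂ)`, `τ = tr`: `ρ(ℓ) = Σ_{ij} ℓ(E_{ij})E_{ji}`); the sequel CONSTRUCTS it from the cell's Hilbert-fibre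
convention (`B9Eq310HessianOperator` (M2): `⟪φ⁻¹X, φ⁻¹Y⟫ = τ(X*Y)`) as `ρ(ℓ) = (φ v_ℓ)*`, `⟪v_ℓ, ·⟫ = ℓ ∘ φ` — NOT the conjugate-linear Riesz vector
itself, which would make the current anti-holomorphic (sequel `B11Eq98V0primeCurrentSlots` §7).

WHAT IS DEFINED AND PROVED (sorry-free; axioms `propext` / `Classical.choice` / `Quot.sound`; no `Prop`-valued definition, no new named fact).
§4 `Tsh`, `Ucur`, `curL` (+ `curL_apply`), `flat115` (the underlying bond function of a (115) configuration as a CLM), the dictionary lemma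
   **`curlη_curL_eq_nabla115`**; **`curV0prime ρ τ U₀ : Space115 L η lev₀ lev₁ Dc → NegSize L η lev₀ 3 𝔸`** —
   `cur(Y)(b) = Σ_{p∈st(b)} ρ(((∂/∂A(b))V′₀)(Y, ∂p))` (`curV0prime_apply`), for ANY derivative letter `Dc` (the current does not involve `∇Y`);
   **`differentiable_curV0prime`** — `cur` IS FRÉCHET-DIFFERENTIABLE EVERYWHERE (the `an₄` clause; from `B11Eq90V0primeBond.contDiff_V0primeP`).
§5 `eta_le_levWeight_one` (`η ≦ Lʲη` for `1 ≦ L`), **`opNorm_dV0primeBond_carrier_le`** (at a (115) configuration with `‖Y‖ < ε₃ ≦ 1/16`: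
   `‖(∂/∂A(b))V′₀(Y, ∂q)‖ ≦ 512ε₃²(K + ε₃)/w(q)³`, `w(q)` the plaquette weight, `K = C₁B₃ε₁` of (38)), **`norm_curV0prime_le`** — THE
   `|·|_{(−3)}` BOUND: `‖cur(Y)‖₍₋₃₎ ≦ 1024(d − 1)Λ³‖ρ‖·ε₃²(K + ε₃)`, **`est90_curV0prime`** (the same in the letters of
   `TermwiseDatum.est90`: `≦ K₄ε₃²(ε₁ + ε₃)`, `K₄ = 1024(d − 1)Λ³‖ρ‖max{C₁B₃, 1}`), **`norm_curV0prime_le_sq`** (the (98)-form `≦ C‖Y‖²`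
   on `‖Y‖ < 1/16`; the slot structures `B11Prop6Scheme.Prop4Hyp` / `B13Contraction113.QuadAnalytic` are inhabited from it in the sequel).
HYPOTHESES OF §5 (all print's, displayed; nothing of (14)/(38) derived): `1 ≦ L`; unitary background in the unit balls (`U₀(b)⁻¹ = U₀(b)*`,
`‖U₀(b)‖, ‖U₀(b)⁻¹‖ ≦ 1`); tracial `*`-trace `τ`; per positively oriented plaquette `q` the (38)/(31) trace slots of `B11Eq36Complex` with
`κ_q = K/w(q)²` («|Re U₀(∂p) − 1| … C₁B₃ε₁η²(Lʲη)⁻²», `|tr(Z η⁻² Im U₀(∂p))| ≦ |Z|κ`, `|tr(Z U₀(∂p)^{±1})| ≦ |Z|`) read at the plaquette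
weight `w(q) = min_{b⊂∂q} Lʲ⁽ᵇ⁾η` (= the scale of the coarsest `Ω_j ⊇ ∂q`); the LEVEL GEOMETRY letter `Λ`: `Lʲ⁽ᵇ⁾η ≦ Λ·w(q)` for `b ⊂ ∂q`
(print: the domain-sequence conditions of [6] Sect. A invoked on p. 278 via (2) — neighbouring points differ by at most one level, `Λ = L`) —
hence «C₄ depend[s] on d and L only».

HONEST SCOPE — what is NOT claimed.  (i) THIS IS THE V′₀-CURRENT AT `A`, i.e. the first sum of (90) read at `A = A′ − HD(A′)` (whose (57)
bound `|A| < 2ε₃(Lʲη)⁻¹` is print's input); the composition with (47) and the `𝔇*(A′)H*` term (the factor `n(1 + θ)` of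
`B11Eq85FirstDerivative.ineq90`), the commutator group (91)–(96) and the groups (85)–(89) are NOT touched: the V′₀-SUMMAND of letter (L3)
with its two `Regime.quad` clauses proved, NOT (L3) `W`.  (ii) `ρ` is a datum with its defining display (constructed in the sequel from the
cell's fibre convention; in the matrix model with the operator norm `‖ρ‖ ≦ 1` uniformly in N — the dual of the operator norm is the trace
norm); `K`, `Λ` are letters.  (iii) DIVERGENCE D-pv27.4 inherited (abstract `τ`;
`η`, `L` real parameters).  (iv) Constants `512`, `1024`, `1/16` are witnesses of print's «O(1)» / «a₃ sufficiently small».  (v) NOT summit progress (cell pub-balaban: NE9 NOT PRINTED / NOT PROVED; spine PROVED 0/9).  (vi) ROBUSTNESS (for consumers): with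
`B9Eq311L2Pairing` also imported, its constant-weight instance `WL2.instFactConst` is tried on goals `Fact (∀ b, 0 < levWeight …)` and the
unifier then unfolds real powers (whnf timeout); raise `levWeight.instFact` locally there (`attribute [local instance 2000] levWeight.instFact`).  Unit
`b2b-balaban-t4-ne9-formalise-leaf-05` (NE9 crux-team leaf prover, gen 64).  Imports `B11Eq90V0primeBond` (this lineage), `B11Eq111FrakG`
(this lineage; for `nabla115`, `B11Eq115Space`, `B9Eq33CovDerivVector.shiftEquiv`) ONLY; modifies nothing of r08's or of the owner's.
-/

noncomputable section

open NormedSpace Complex Metric Set Finset Filter Topology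

namespace Literature.MathematicalPhysics.QuantumFieldTheory.Balaban1983to89.B11Eq90V0primeCurrent

open Literature.MathematicalPhysics.QuantumFieldTheory.Balaban1983to89.Beta.TransportVertices
open Literature.MathematicalPhysics.QuantumFieldTheory.Balaban1983to89.B9Eq37Insertion
open Literature.MathematicalPhysics.QuantumFieldTheory.Balaban1983to89.B9Eq39Adjoint
open Literature.MathematicalPhysics.QuantumFieldTheory.Balaban1983to89.B11Eq90V0Derivative
open Literature.MathematicalPhysics.QuantumFieldTheory.Balaban1983to89.B11Eq90StB
open Literature.MathematicalPhysics.QuantumFieldTheory.Balaban1983to89.B11Eq90V0primeBond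
open B9SectCLatticeCarrier (Bond) open B4Sect5Torus (TSite) open B9Eq33CovDerivVector (shiftEquiv)
open B11Eq115Space
open B11Eq111FrakG (nabla115 nabla115_apply)

variable {𝔸 : Type*} [NormedRing 𝔸] [NormedAlgebra ℂ 𝔸] [CompleteSpace 𝔸]

/-! ## §4 The torus bridge and the V′₀-current on the (115) carriers -/

section Carrier

variable {d : ℕ} {Pd : Fin d → ℕ}

/-- [5]'s shifts `T μ : x ↦ x + e_μ` on the periodic lattice (`B9Eq33CovDerivVector.shiftEquiv`), in r08's letter `T : ι → Equiv.Perm S`.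
[cite: Balaban1985BackgroundPropagators, (3.3) p.390] -/
abbrev Tsh : Fin d → Equiv.Perm (TSite d Pd) := fun μ => shiftEquiv μ

omit [NormedRing 𝔸] [NormedAlgebra ℂ 𝔸] [CompleteSpace 𝔸] in
/-- The background `U₀` on the bonds `(x, μ)` in r08's currying `U μ x = U₀(x, x + e_μ)`. [cite: Balaban1985BackgroundPropagators, (3.3) p.390] -/
abbrev Ucur (U₀ : Bond d Pd → 𝔸ˣ) : Fin d → TSite d Pd → 𝔸ˣ := fun μ x => U₀ (x, μ)

omit [CompleteSpace 𝔸] in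
/-- **«the identification A(x, x + ηe_μ) = A_μ(x)»** ([5] p. 391): a bond function `Y : Bond → 𝔸` read as r08's configuration `A μ x = Y(x, μ)`,
as a continuous linear map. [cite: Balaban1985BackgroundPropagators, (3.3) p.391] -/
def curL : (Bond d Pd → 𝔸) →L[ℂ] (Fin d → TSite d Pd → 𝔸) :=
  ContinuousLinearMap.pi fun μ => ContinuousLinearMap.pi fun x =>
    (ContinuousLinearMap.proj (R := ℂ) (φ := fun _ : Bond d Pd => 𝔸) (x, μ))

omit [CompleteSpace 𝔸] in
/-- Unfolding the identification: `curL Y μ x = Y(x, μ)`. [cite: Balaban1985BackgroundPropagators, (3.3) p.391] -/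
@[simp] theorem curL_apply (f : Bond d Pd → 𝔸) (μ : Fin d) (x : TSite d Pd) : curL f μ x = f (x, μ) := rfl

omit [CompleteSpace 𝔸] in
/-- **THE BRIDGE IS THE RIGHT ONE**: under the identification, r08's covariant curl `(D^η_{U₀}A)(p_{μν}(x))` ([5] (3.4), `B9Eq39Adjoint.curlη`)
IS `(∇_μ A_ν)(x) − (∇_ν A_μ)(x)` for the derivative letter `∇ = nabla115 η U₀` of the space (115) ([5] p. 391: «(D^η_{U₀}A)(p_{μν}(x)) =
(D^η_{U₀,μ}A_ν)(x) − (D^η_{U₀,ν}A_μ)(x)»). [cite: Balaban1985BackgroundPropagators, (3.4) p.391] -/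
theorem curlη_curL_eq_nabla115 (η : ℝ) (U₀ : Bond d Pd → 𝔸ˣ) (f : Bond d Pd → 𝔸) (μ ν : Fin d) (x : TSite d Pd) :
    curlη Tsh (Ucur U₀) η (curL f) μ ν x = nabla115 η U₀ f ((x, μ), ν) - nabla115 η U₀ f ((x, ν), μ) := by
  simp only [curlη, curl, covD, R_def, smul_sub, nabla115_apply, curL_apply]
  rfl

variable {L η : ℝ} [Fact (0 < L)] [Fact (0 < η)] {lev₀ : Bond d Pd → ℕ} {κ' : Type*} [Fintype κ'] {lev₁ : κ' → ℕ}
  {Dc : (Bond d Pd → 𝔸) →ₗ[ℂ] (κ' → 𝔸)}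

omit [CompleteSpace 𝔸] in
/-- The underlying bond function of a (115) configuration, as a continuous linear map (`fst` then the flat identification; norm `≦ (min w)⁻¹`).
[cite: Balaban1985Variational, (115) p.294] -/
def flat115 : Space115 L η lev₀ lev₁ Dc →L[ℂ] (Bond d Pd → 𝔸) :=
  (NegSup.continuousLinearEquiv ℂ (levWeight L η lev₀ 1)).toContinuousLinearMap.comp
    (JetSup.fstCLM (levWeight L η lev₀ 1) (levWeight L η lev₁ 2) Dc)

omit [CompleteSpace 𝔸] in
/-- Unfolding: `flat115 Y` is the function underlying `Y`. [cite: Balaban1985Variational, (115) p.294] -/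
@[simp] theorem flat115_apply (Y : Space115 L η lev₀ lev₁ Dc) :
    flat115 Y = JetSup.equiv (levWeight L η lev₀ 1) (levWeight L η lev₁ 2) Dc Y := rfl

/-- **THE V′₀-CURRENT ON THE CARRIERS OF (115)**: for a configuration `Y` of the space (115) (underlying `A = curL Y`), the `|·|_{(−3)}`-carrier
element `cur(Y)(b) = Σ_{p∈st(b)} ρ(((∂/∂A(b))V′₀)(A, ∂p))` (= the sum over ALL positively oriented plaquettes, the others contributing `0`,
`B11Eq90V0primeBond.dV0primeBond_eq_zero_of_not_mem_st`) — the first sum of (90) read at `A`, each one-bond functional (63) represented in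
`𝔸` through the dualising map `ρ` of the pairing (27); a map `Space115 L η lev₀ lev₁ Dc → NegSize L η lev₀ 3 𝔸` for ANY derivative letter `Dc`
(the W-slot type of `B11Eq115Space.chartHB115` / `B11Eq103H1Complex.chartOfLetters`). [cite: Balaban1985Variational, (90) p.291, (63) p.287, (27) p.282] -/
def curV0prime (ρ : (𝔸 →L[ℂ] ℂ) →L[ℂ] 𝔸) (τ : 𝔸 →L[ℂ] ℂ) (U₀ : Bond d Pd → 𝔸ˣ)
    (Y : Space115 L η lev₀ lev₁ Dc) : NegSize L η lev₀ 3 𝔸 :=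
  (NegSup.equiv (levWeight L η lev₀ 3) 𝔸).symm fun b =>
    ∑ q ∈ st Tsh b.2 b.1, ρ (dV0primeBond Tsh (Ucur U₀) η τ (curL (JetSup.equiv (levWeight L η lev₀ 1) (levWeight L η lev₁ 2) Dc Y)) q b.2 b.1)

omit [CompleteSpace 𝔸] [Fact (0 < L)] [Fact (0 < η)] [Fintype κ'] in
/-- Unfolding the current at a bond `b = (x, μ)`: `Σ_{p∈st(b)} ρ((∂/∂A(b))V′₀(A, ∂p))`. [cite: Balaban1985Variational, (90) p.291] -/
theorem curV0prime_apply (ρ : (𝔸 →L[ℂ] ℂ) →L[ℂ] 𝔸) (τ : 𝔸 →L[ℂ] ℂ) (U₀ : Bond d Pd → 𝔸ˣ)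
    (Y : Space115 L η lev₀ lev₁ Dc) (b : Bond d Pd) :
    NegSup.equiv (levWeight L η lev₀ 3) 𝔸 (curV0prime (lev₁ := lev₁) (Dc := Dc) ρ τ U₀ Y) b
      = ∑ q ∈ st Tsh b.2 b.1, ρ (dV0primeBond Tsh (Ucur U₀) η τ (curL (JetSup.equiv (levWeight L η lev₀ 1) (levWeight L η lev₁ 2) Dc Y)) q b.2 b.1) := rfl

/-- **THE CURRENT IS AN ENTIRE FUNCTION OF THE CONFIGURATION** (Fréchet, on the whole space (115)) — Prop. 4's «The functional derivative of
V(A′) is an analytic function on this space» for the V′₀-group; the `an₄` clause of `B11Prop4Assembly.TermwiseDatum` / the `differentiableOn` of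
`B11Prop6Scheme.Prop4Hyp` at the carrier. [cite: Balaban1985Variational, Prop. 4 p.292] -/
theorem differentiable_curV0prime (ρ : (𝔸 →L[ℂ] ℂ) →L[ℂ] 𝔸) (τ : 𝔸 →L[ℂ] ℂ) (U₀ : Bond d Pd → 𝔸ˣ) :
    Differentiable ℂ (curV0prime (L := L) (η := η) (lev₀ := lev₀) (lev₁ := lev₁) (Dc := Dc) ρ τ U₀) := by
  show Differentiable ℂ (fun Y => (NegSup.continuousLinearEquiv ℂ (levWeight L η lev₀ 3)).symm (fun b =>
    ∑ q ∈ st Tsh b.2 b.1, ρ (dV0primeBond Tsh (Ucur U₀) η τ (curL (flat115 Y)) q b.2 b.1)))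
  refine (ContinuousLinearEquiv.differentiable _).comp (differentiable_pi.2 fun b => ?_)
  refine Differentiable.fun_sum fun q _ => ρ.differentiable.comp ?_
  exact differentiable_dV0primeBond_comp Tsh (Ucur U₀)
    ((curL : (Bond d Pd → 𝔸) →L[ℂ] (Fin d → TSite d Pd → 𝔸)).comp
      (flat115 (L := L) (η := η) (lev₀ := lev₀) (lev₁ := lev₁) (Dc := Dc))) η τ q b.2 b.1

/-! ## §5 The `|·|_{(−3)}` bound of the current: (90)'s «O(1)ε₃²(ε₁ + ε₃)(Lʲη)⁻³ on Ω_j» -/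

variable [NormOneClass 𝔸] [StarRing 𝔸] [StarModule ℂ 𝔸]

omit [Fintype κ'] [Fact (0 < L)] [NormOneClass 𝔸] [StarRing 𝔸] [StarModule ℂ 𝔸] [CompleteSpace 𝔸] [NormedAlgebra ℂ 𝔸] [NormedRing 𝔸] in
/-- `η ≦ Lʲη` for `1 ≦ L` (print's standing `η ≦ Lʲη`, used in (32)/(40)/(90)). [cite: Balaban1985Variational, (40) p.284] -/
theorem eta_le_levWeight_one (hL : 1 ≤ L) (b : Bond d Pd) : η ≤ levWeight L η lev₀ 1 b := by
  rw [levWeight_apply, pow_one]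
  exact le_mul_of_one_le_left (Fact.out : 0 < η).le (one_le_pow₀ hL)

/-- **THE ONE-BOND FUNCTIONAL AT A (115) CONFIGURATION**: for `‖Y‖ < ε₃ ≦ 1/16` (so `|Y(b)| < ε₃(Lʲ⁽ᵇ⁾η)⁻¹`, (57)/(77)-type data) and a plaquette
`q` with the (38)/(31) trace slots at its weight `w(q)` (`κ_q = K/w(q)²`), `‖(∂/∂A(b))V′₀(Y, ∂q)‖_{op} ≦ 512ε₃²(K + ε₃)/w(q)³` — p. 291's sentence
with `|Y|(∂q) ≦ 4ε₃/w(q)`, `e^{2η·4ε₃/w(q)} ≦ e^{1/2} ≦ 2` (`η ≦ w(q)`). [cite: Balaban1985Variational, (90) p.291, (40) p.284] -/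
theorem opNorm_dV0primeBond_carrier_le (τ : 𝔸 →L[ℂ] ℂ) (U₀ : Bond d Pd → 𝔸ˣ)
    (hU : ∀ b, (((U₀ b)⁻¹ : 𝔸ˣ) : 𝔸) = star (U₀ b : 𝔸))
    (hUn : ∀ b, ‖(U₀ b : 𝔸)‖ ≤ 1 ∧ ‖(((U₀ b)⁻¹ : 𝔸ˣ) : 𝔸)‖ ≤ 1)
    (hτ : ∀ a b : 𝔸, τ (a * b) = τ (b * a)) (hτs : ∀ a : 𝔸, τ (star a) = starRingEnd ℂ (τ a))
    (hL : 1 ≤ L) {K ε₃ : ℝ} (hK : 0 ≤ K) (hε₃ : 0 < ε₃) (ha : ε₃ ≤ 1 / 16)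
    (q : TSite d Pd × Fin d × Fin d)
    (hRe1 : ∀ Z : 𝔸, ‖(τ : 𝔸 →ₗ[ℂ] ℂ) (Z * (reC (plaqU Tsh (Ucur U₀) q.2.1 q.2.2 q.1) - 1))‖
      ≤ ‖Z‖ * (η ^ 2 * (K / plaqWeight Tsh (levWeight L η lev₀ 1) q ^ 2)))
    (hIm : ∀ Z : 𝔸, ‖(τ : 𝔸 →ₗ[ℂ] ℂ) (Z * (((η : ℂ) ^ 2)⁻¹ • imC (plaqU Tsh (Ucur U₀) q.2.1 q.2.2 q.1)))‖
      ≤ ‖Z‖ * (K / plaqWeight Tsh (levWeight L η lev₀ 1) q ^ 2))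
    (hW : ∀ Z : 𝔸, ‖(τ : 𝔸 →ₗ[ℂ] ℂ) (Z * (plaqU Tsh (Ucur U₀) q.2.1 q.2.2 q.1 : 𝔸))‖ ≤ ‖Z‖)
    (hW' : ∀ Z : 𝔸, ‖(τ : 𝔸 →ₗ[ℂ] ℂ) (Z * (((plaqU Tsh (Ucur U₀) q.2.1 q.2.2 q.1)⁻¹ : 𝔸ˣ) : 𝔸))‖ ≤ ‖Z‖)
    (Y : Space115 L η lev₀ lev₁ Dc) (hY : ‖Y‖ < ε₃) (μ₀ : Fin d) (x₀ : TSite d Pd) :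
    ‖dV0primeBond Tsh (Ucur U₀) η τ (curL (JetSup.equiv (levWeight L η lev₀ 1) (levWeight L η lev₁ 2) Dc Y)) q μ₀ x₀‖
      ≤ 512 * ε₃ ^ 2 * (K + ε₃) / plaqWeight Tsh (levWeight L η lev₀ 1) q ^ 3 := by
  have hη : 0 < η := Fact.out
  set w : Bond d Pd → ℝ := levWeight L η lev₀ 1 with hw
  have hw0 : ∀ b, 0 < w b := levWeight_pos (Fact.out) hη lev₀ 1
  set pw := plaqWeight Tsh w q with hpw
  have hpw0 : 0 < pw := plaqWeight_pos Tsh hw0 q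
  have hηpw : η ≤ pw := le_plaqWeight Tsh (eta_le_levWeight_one (lev₀ := lev₀) hL) q
  set A := curL (JetSup.equiv (levWeight L η lev₀ 1) (levWeight L η lev₁ 2) Dc Y) with hA
  -- the letters of `A` around `∂q` are `≤ ε₃ / w(q)`
  have hAb : ∀ (κ : Fin d) (y : TSite d Pd), pw ≤ w (y, κ) → ‖A κ y‖ ≤ pw⁻¹ * ε₃ := by
    intro κ y hle
    have h1 : ‖A κ y‖ ≤ (w (y, κ))⁻¹ * ‖Y‖ := by
      have := NegSup.norm_apply_le (JetSup.fst Y) (y, κ)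
      exact this.trans (mul_le_mul_of_nonneg_left (JetSup.norm_fst_le Y) (inv_nonneg.2 (hw0 _).le))
    exact h1.trans (mul_le_mul (inv_anti₀ hpw0 hle) hY.le (norm_nonneg _) (inv_nonneg.2 hpw0.le))
  set s : ℝ := 4 * (pw⁻¹ * ε₃) with hs_def
  have hs0 : 0 < s := by positivity
  have hs : size (lettersA Tsh (Ucur U₀) A q.2.1 q.2.2 q.1) ≤ s := by
    rw [size_lettersA]
    have h1 := (norm_R_le (hUn (q.1, q.2.2)).1 (hUn (q.1, q.2.2)).2 (A q.2.1 (Tsh q.2.2 q.1))).trans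
      (hAb q.2.1 (Tsh q.2.2 q.1) (plaqWeight_le₃ Tsh w q))
    have h2 := hAb q.2.2 q.1 (plaqWeight_le₄ Tsh w q)
    have h3 := hAb q.2.1 q.1 (plaqWeight_le₁ Tsh w q)
    have h4 := (norm_R_le (hUn (q.1, q.2.1)).1 (hUn (q.1, q.2.1)).2 (A q.2.2 (Tsh q.2.1 q.1))).trans
      (hAb q.2.2 (Tsh q.2.1 q.1) (plaqWeight_le₂ Tsh w q))
    simp only [Ucur] at h1 h4 ⊢
    linarith
  have hexp : Real.exp (2 * η * s) ≤ 2 := by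
    have hx : 2 * η * s ≤ 1 / 2 := by
      have : η * pw⁻¹ ≤ 1 := by rw [mul_inv_le_iff₀ hpw0, one_mul]; exact hηpw
      nlinarith
    calc Real.exp (2 * η * s) ≤ Real.exp (1 / 2) := Real.exp_le_exp.2 hx
      _ ≤ 1 / (1 - 1 / 2) := Real.exp_bound_div_one_sub_of_interval (by norm_num) (by norm_num)
      _ = 2 := by norm_num
  have hκ : 0 ≤ K / pw ^ 2 := by positivity
  have h := opNorm_dV0primeBond_le Tsh (Ucur U₀) (fun μ x => hU (x, μ)) (fun μ x => hUn (x, μ)) τ hτ hτs hη hκ A q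
    μ₀ x₀ hs hs0 hexp hRe1 hIm hW hW'
  refine h.trans ?_
  have e : 4 * (8 * s ^ 2 * η * (K / pw ^ 2) + 4 / 3 * s ^ 3)
      = 512 * ε₃ ^ 2 * K / pw ^ 3 * (η * pw⁻¹) + 1024 / 3 * ε₃ ^ 3 / pw ^ 3 := by
    simp only [hs_def]
    field_simp
    ring
  rw [e]
  have hηpw' : η * pw⁻¹ ≤ 1 := by rw [mul_inv_le_iff₀ hpw0, one_mul]; exact hηpw
  have t1 : 512 * ε₃ ^ 2 * K / pw ^ 3 * (η * pw⁻¹) ≤ 512 * ε₃ ^ 2 * K / pw ^ 3 :=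
    mul_le_of_le_one_right (by positivity) hηpw'
  have t2 : 1024 / 3 * ε₃ ^ 3 / pw ^ 3 ≤ 512 * ε₃ ^ 3 / pw ^ 3 := by
    gcongr; norm_num
  calc _ ≤ 512 * ε₃ ^ 2 * K / pw ^ 3 + 512 * ε₃ ^ 3 / pw ^ 3 := add_le_add t1 t2
    _ = 512 * ε₃ ^ 2 * (K + ε₃) / pw ^ 3 := by ring

/-- **THE `|·|_{(−3)}` BOUND OF THE V′₀-CURRENT** — «This implies that the functional derivative (90) can be estimated by O(1)ε₃²(ε₁ + ε₃)(Lʲη)⁻³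
on Ω_j», for its first sum read at `A`: for `‖Y‖ < ε₃ ≦ 1/16` (`‖·‖` = the (115) size `max{|·|₍₋₁₎, |∇·|₍₋₂₎}`),
`‖cur(Y)‖₍₋₃₎ ≦ 1024(d − 1)Λ³‖ρ‖·ε₃²(K + ε₃)` — the weight `(Lʲ⁽ᵇ⁾η)³` against `#st(b) ≦ 2(d − 1)` one-bond functionals of size
`512ε₃²(K + ε₃)/w(q)³` (`opNorm_dV0primeBond_carrier_le`) and the level-geometry letter `Lʲ⁽ᵇ⁾η ≦ Λw(q)`. [cite: Balaban1985Variational, (90) p.291, (97) p.293] -/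
theorem norm_curV0prime_le (ρ : (𝔸 →L[ℂ] ℂ) →L[ℂ] 𝔸) (τ : 𝔸 →L[ℂ] ℂ) (U₀ : Bond d Pd → 𝔸ˣ)
    (hU : ∀ b, (((U₀ b)⁻¹ : 𝔸ˣ) : 𝔸) = star (U₀ b : 𝔸))
    (hUn : ∀ b, ‖(U₀ b : 𝔸)‖ ≤ 1 ∧ ‖(((U₀ b)⁻¹ : 𝔸ˣ) : 𝔸)‖ ≤ 1)
    (hτ : ∀ a b : 𝔸, τ (a * b) = τ (b * a)) (hτs : ∀ a : 𝔸, τ (star a) = starRingEnd ℂ (τ a))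
    (hL : 1 ≤ L) {K Λ ε₃ : ℝ} (hK : 0 ≤ K) (hε₃ : 0 < ε₃) (ha : ε₃ ≤ 1 / 16) (hΛ0 : 0 ≤ Λ)
    (hΛ : ∀ q ∈ posPlaq (TSite d Pd) (Fin d), ∀ (μ₀ : Fin d) (x₀ : TSite d Pd), q ∈ st Tsh μ₀ x₀ →
      levWeight L η lev₀ 1 (x₀, μ₀) ≤ Λ * plaqWeight Tsh (levWeight L η lev₀ 1) q)
    (hRe1 : ∀ q ∈ posPlaq (TSite d Pd) (Fin d), ∀ Z : 𝔸,
      ‖(τ : 𝔸 →ₗ[ℂ] ℂ) (Z * (reC (plaqU Tsh (Ucur U₀) q.2.1 q.2.2 q.1) - 1))‖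
        ≤ ‖Z‖ * (η ^ 2 * (K / plaqWeight Tsh (levWeight L η lev₀ 1) q ^ 2)))
    (hIm : ∀ q ∈ posPlaq (TSite d Pd) (Fin d), ∀ Z : 𝔸,
      ‖(τ : 𝔸 →ₗ[ℂ] ℂ) (Z * (((η : ℂ) ^ 2)⁻¹ • imC (plaqU Tsh (Ucur U₀) q.2.1 q.2.2 q.1)))‖
        ≤ ‖Z‖ * (K / plaqWeight Tsh (levWeight L η lev₀ 1) q ^ 2))
    (hW : ∀ q ∈ posPlaq (TSite d Pd) (Fin d), ∀ Z : 𝔸,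
      ‖(τ : 𝔸 →ₗ[ℂ] ℂ) (Z * (plaqU Tsh (Ucur U₀) q.2.1 q.2.2 q.1 : 𝔸))‖ ≤ ‖Z‖)
    (hW' : ∀ q ∈ posPlaq (TSite d Pd) (Fin d), ∀ Z : 𝔸,
      ‖(τ : 𝔸 →ₗ[ℂ] ℂ) (Z * (((plaqU Tsh (Ucur U₀) q.2.1 q.2.2 q.1)⁻¹ : 𝔸ˣ) : 𝔸))‖ ≤ ‖Z‖)
    (Y : Space115 L η lev₀ lev₁ Dc) (hY : ‖Y‖ < ε₃) :
    ‖curV0prime (lev₁ := lev₁) (Dc := Dc) ρ τ U₀ Y‖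
      ≤ 1024 * ((d - 1 : ℕ) : ℝ) * Λ ^ 3 * ‖ρ‖ * (ε₃ ^ 2 * (K + ε₃)) := by
  have hη : 0 < η := Fact.out
  set w : Bond d Pd → ℝ := levWeight L η lev₀ 1 with hw
  have hw0 : ∀ b, 0 < w b := levWeight_pos (Fact.out) hη lev₀ 1
  have hC : 0 ≤ 512 * ε₃ ^ 2 * (K + ε₃) := by positivity
  refine (NegSup.norm_le_iff (by positivity)).2 fun b => ?_
  have hwb : 0 < w b := hw0 b
  rw [curV0prime_apply]
  have hw3 : levWeight L η lev₀ 3 b = w b ^ 3 := by simp [hw, levWeight_apply]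
  rw [hw3]
  have hterm : ∀ q ∈ st Tsh b.2 b.1,
      w b ^ 3 * ‖ρ (dV0primeBond Tsh (Ucur U₀) η τ (curL (JetSup.equiv (levWeight L η lev₀ 1) (levWeight L η lev₁ 2) Dc Y)) q b.2 b.1)‖
        ≤ Λ ^ 3 * ‖ρ‖ * (512 * ε₃ ^ 2 * (K + ε₃)) := by
    intro q hq
    have hqP : q ∈ posPlaq (TSite d Pd) (Fin d) := st_subset_posPlaq Tsh b.2 b.1 hq
    have hpw0 : 0 < plaqWeight Tsh w q := plaqWeight_pos Tsh hw0 q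
    have hℓ := opNorm_dV0primeBond_carrier_le (lev₁ := lev₁) (Dc := Dc) τ U₀ hU hUn hτ hτs hL hK hε₃ ha q
      (hRe1 q hqP) (hIm q hqP) (hW q hqP) (hW' q hqP) Y hY b.2 b.1
    have hρℓ := (ρ.le_opNorm _).trans (mul_le_mul_of_nonneg_left hℓ (norm_nonneg ρ))
    have hrat : w b ^ 3 / plaqWeight Tsh w q ^ 3 ≤ Λ ^ 3 := by
      rw [← div_pow]
      exact pow_le_pow_left₀ (by positivity) ((div_le_iff₀ hpw0).2 (hΛ q hqP b.2 b.1 hq)) 3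
    calc w b ^ 3 * ‖ρ (dV0primeBond Tsh (Ucur U₀) η τ (curL (JetSup.equiv (levWeight L η lev₀ 1) (levWeight L η lev₁ 2) Dc Y)) q b.2 b.1)‖
        ≤ w b ^ 3 * (‖ρ‖ * (512 * ε₃ ^ 2 * (K + ε₃) / plaqWeight Tsh w q ^ 3)) :=
          mul_le_mul_of_nonneg_left hρℓ (by positivity)
      _ = (w b ^ 3 / plaqWeight Tsh w q ^ 3) * (‖ρ‖ * (512 * ε₃ ^ 2 * (K + ε₃))) := by ring
      _ ≤ Λ ^ 3 * (‖ρ‖ * (512 * ε₃ ^ 2 * (K + ε₃))) :=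
          mul_le_mul_of_nonneg_right hrat (by positivity)
      _ = Λ ^ 3 * ‖ρ‖ * (512 * ε₃ ^ 2 * (K + ε₃)) := by ring
  have hcard := card_st_le Tsh b.2 b.1
  rw [Fintype.card_fin] at hcard
  calc w b ^ 3 * ‖∑ q ∈ st Tsh b.2 b.1, ρ (dV0primeBond Tsh (Ucur U₀) η τ (curL (JetSup.equiv (levWeight L η lev₀ 1) (levWeight L η lev₁ 2) Dc Y)) q b.2 b.1)‖
      ≤ w b ^ 3 * ∑ q ∈ st Tsh b.2 b.1, ‖ρ (dV0primeBond Tsh (Ucur U₀) η τ (curL (JetSup.equiv (levWeight L η lev₀ 1) (levWeight L η lev₁ 2) Dc Y)) q b.2 b.1)‖ :=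
        mul_le_mul_of_nonneg_left (norm_sum_le _ _) (by positivity)
    _ = ∑ q ∈ st Tsh b.2 b.1, w b ^ 3 * ‖ρ (dV0primeBond Tsh (Ucur U₀) η τ (curL (JetSup.equiv (levWeight L η lev₀ 1) (levWeight L η lev₁ 2) Dc Y)) q b.2 b.1)‖ :=
        Finset.mul_sum _ _ _
    _ ≤ ∑ q ∈ st Tsh b.2 b.1, Λ ^ 3 * ‖ρ‖ * (512 * ε₃ ^ 2 * (K + ε₃)) := Finset.sum_le_sum hterm
    _ = (st Tsh b.2 b.1).card * (Λ ^ 3 * ‖ρ‖ * (512 * ε₃ ^ 2 * (K + ε₃))) := by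
        rw [Finset.sum_const, nsmul_eq_mul]
    _ ≤ (2 * (d - 1) : ℕ) * (Λ ^ 3 * ‖ρ‖ * (512 * ε₃ ^ 2 * (K + ε₃))) := by
        have hΛ3 : 0 ≤ Λ ^ 3 * ‖ρ‖ * (512 * ε₃ ^ 2 * (K + ε₃)) := by positivity
        gcongr
    _ = 1024 * ((d - 1 : ℕ) : ℝ) * Λ ^ 3 * ‖ρ‖ * (ε₃ ^ 2 * (K + ε₃)) := by push_cast; ring

/-- **THE (90)-LEAF IN THE LETTERS OF `B11Prop4Assembly.TermwiseDatum.est90`** — `‖W₄ Y‖ ≦ K₄ε₃²(ε₁ + ε₃)` for `0 < ε₃ ≦ a`, `‖Y‖ < ε₃`: with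
`K = C₁B₃ε₁` ((38)), `a = 1/16` and `K₄ := 1024(d − 1)Λ³‖ρ‖·max{C₁B₃, 1}` (`C₁B₃ε₁ + ε₃ ≦ max{C₁B₃, 1}(ε₁ + ε₃)`), for the V′₀-current at `A`.
[cite: Balaban1985Variational, (90) p.291, (97) p.293] -/
theorem est90_curV0prime (ρ : (𝔸 →L[ℂ] ℂ) →L[ℂ] 𝔸) (τ : 𝔸 →L[ℂ] ℂ) (U₀ : Bond d Pd → 𝔸ˣ)
    (hU : ∀ b, (((U₀ b)⁻¹ : 𝔸ˣ) : 𝔸) = star (U₀ b : 𝔸))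
    (hUn : ∀ b, ‖(U₀ b : 𝔸)‖ ≤ 1 ∧ ‖(((U₀ b)⁻¹ : 𝔸ˣ) : 𝔸)‖ ≤ 1)
    (hτ : ∀ a b : 𝔸, τ (a * b) = τ (b * a)) (hτs : ∀ a : 𝔸, τ (star a) = starRingEnd ℂ (τ a))
    (hL : 1 ≤ L) {C₁B₃ ε₁ Λ : ℝ} (hC : 0 ≤ C₁B₃) (hε₁ : 0 ≤ ε₁) (hΛ0 : 0 ≤ Λ)
    (hΛ : ∀ q ∈ posPlaq (TSite d Pd) (Fin d), ∀ (μ₀ : Fin d) (x₀ : TSite d Pd), q ∈ st Tsh μ₀ x₀ →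
      levWeight L η lev₀ 1 (x₀, μ₀) ≤ Λ * plaqWeight Tsh (levWeight L η lev₀ 1) q)
    (hRe1 : ∀ q ∈ posPlaq (TSite d Pd) (Fin d), ∀ Z : 𝔸,
      ‖(τ : 𝔸 →ₗ[ℂ] ℂ) (Z * (reC (plaqU Tsh (Ucur U₀) q.2.1 q.2.2 q.1) - 1))‖
        ≤ ‖Z‖ * (η ^ 2 * (C₁B₃ * ε₁ / plaqWeight Tsh (levWeight L η lev₀ 1) q ^ 2)))
    (hIm : ∀ q ∈ posPlaq (TSite d Pd) (Fin d), ∀ Z : 𝔸,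
      ‖(τ : 𝔸 →ₗ[ℂ] ℂ) (Z * (((η : ℂ) ^ 2)⁻¹ • imC (plaqU Tsh (Ucur U₀) q.2.1 q.2.2 q.1)))‖
        ≤ ‖Z‖ * (C₁B₃ * ε₁ / plaqWeight Tsh (levWeight L η lev₀ 1) q ^ 2))
    (hW : ∀ q ∈ posPlaq (TSite d Pd) (Fin d), ∀ Z : 𝔸,
      ‖(τ : 𝔸 →ₗ[ℂ] ℂ) (Z * (plaqU Tsh (Ucur U₀) q.2.1 q.2.2 q.1 : 𝔸))‖ ≤ ‖Z‖)
    (hW' : ∀ q ∈ posPlaq (TSite d Pd) (Fin d), ∀ Z : 𝔸,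
      ‖(τ : 𝔸 →ₗ[ℂ] ℂ) (Z * (((plaqU Tsh (Ucur U₀) q.2.1 q.2.2 q.1)⁻¹ : 𝔸ˣ) : 𝔸))‖ ≤ ‖Z‖) :
    ∀ (ε₃ : ℝ) (Y : Space115 L η lev₀ lev₁ Dc), 0 < ε₃ → ε₃ ≤ 1 / 16 → ‖Y‖ < ε₃ →
      ‖curV0prime (lev₁ := lev₁) (Dc := Dc) ρ τ U₀ Y‖
        ≤ (1024 * ((d - 1 : ℕ) : ℝ) * Λ ^ 3 * ‖ρ‖ * max C₁B₃ 1) * ε₃ ^ 2 * (ε₁ + ε₃) := by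
  intro ε₃ Y hε₃ ha hY
  have hK : 0 ≤ C₁B₃ * ε₁ := mul_nonneg hC hε₁
  have h := norm_curV0prime_le (lev₁ := lev₁) (Dc := Dc) ρ τ U₀ hU hUn hτ hτs hL hK hε₃ ha hΛ0 hΛ hRe1 hIm hW hW' Y hY
  refine h.trans ?_
  have hmax : C₁B₃ * ε₁ + ε₃ ≤ max C₁B₃ 1 * (ε₁ + ε₃) := by
    rw [mul_add]
    exact add_le_add (mul_le_mul_of_nonneg_right (le_max_left _ _) hε₁)
      (le_mul_of_one_le_left hε₃.le (le_max_right _ _))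
  have hpre : 0 ≤ 1024 * ((d - 1 : ℕ) : ℝ) * Λ ^ 3 * ‖ρ‖ := by positivity
  calc 1024 * ((d - 1 : ℕ) : ℝ) * Λ ^ 3 * ‖ρ‖ * (ε₃ ^ 2 * (C₁B₃ * ε₁ + ε₃))
      ≤ 1024 * ((d - 1 : ℕ) : ℝ) * Λ ^ 3 * ‖ρ‖ * (ε₃ ^ 2 * (max C₁B₃ 1 * (ε₁ + ε₃))) := by gcongr
    _ = (1024 * ((d - 1 : ℕ) : ℝ) * Λ ^ 3 * ‖ρ‖ * max C₁B₃ 1) * ε₃ ^ 2 * (ε₁ + ε₃) := by ring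

/-- **THE (98)-FORM AT THE CARRIER**: on the ball `‖Y‖ < 1/16` of the space (115), `‖cur(Y)‖₍₋₃₎ ≦ C·‖Y‖²` with
`C = 1024(d − 1)Λ³‖ρ‖(K + 1/16)` — «|((δ/δA′)V)(A′)|₍₋₃₎ ≦ C₄(max{|A′|₍₋₁₎, |∇A′|₍₋₂₎})²» for the V′₀-current (let `ε₃ ↓ ‖Y‖` in
`norm_curV0prime_le`; the `quad` field of `B11Prop6Scheme.Prop4Hyp` / `B13Contraction113.QuadAnalytic`). [cite: Balaban1985Variational, (98) p.293] -/
theorem norm_curV0prime_le_sq (ρ : (𝔸 →L[ℂ] ℂ) →L[ℂ] 𝔸) (τ : 𝔸 →L[ℂ] ℂ) (U₀ : Bond d Pd → 𝔸ˣ)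
    (hU : ∀ b, (((U₀ b)⁻¹ : 𝔸ˣ) : 𝔸) = star (U₀ b : 𝔸))
    (hUn : ∀ b, ‖(U₀ b : 𝔸)‖ ≤ 1 ∧ ‖(((U₀ b)⁻¹ : 𝔸ˣ) : 𝔸)‖ ≤ 1)
    (hτ : ∀ a b : 𝔸, τ (a * b) = τ (b * a)) (hτs : ∀ a : 𝔸, τ (star a) = starRingEnd ℂ (τ a))
    (hL : 1 ≤ L) {K Λ : ℝ} (hK : 0 ≤ K) (hΛ0 : 0 ≤ Λ)
    (hΛ : ∀ q ∈ posPlaq (TSite d Pd) (Fin d), ∀ (μ₀ : Fin d) (x₀ : TSite d Pd), q ∈ st Tsh μ₀ x₀ →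
      levWeight L η lev₀ 1 (x₀, μ₀) ≤ Λ * plaqWeight Tsh (levWeight L η lev₀ 1) q)
    (hRe1 : ∀ q ∈ posPlaq (TSite d Pd) (Fin d), ∀ Z : 𝔸,
      ‖(τ : 𝔸 →ₗ[ℂ] ℂ) (Z * (reC (plaqU Tsh (Ucur U₀) q.2.1 q.2.2 q.1) - 1))‖
        ≤ ‖Z‖ * (η ^ 2 * (K / plaqWeight Tsh (levWeight L η lev₀ 1) q ^ 2)))
    (hIm : ∀ q ∈ posPlaq (TSite d Pd) (Fin d), ∀ Z : 𝔸,
      ‖(τ : 𝔸 →ₗ[ℂ] ℂ) (Z * (((η : ℂ) ^ 2)⁻¹ • imC (plaqU Tsh (Ucur U₀) q.2.1 q.2.2 q.1)))‖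
        ≤ ‖Z‖ * (K / plaqWeight Tsh (levWeight L η lev₀ 1) q ^ 2))
    (hW : ∀ q ∈ posPlaq (TSite d Pd) (Fin d), ∀ Z : 𝔸,
      ‖(τ : 𝔸 →ₗ[ℂ] ℂ) (Z * (plaqU Tsh (Ucur U₀) q.2.1 q.2.2 q.1 : 𝔸))‖ ≤ ‖Z‖)
    (hW' : ∀ q ∈ posPlaq (TSite d Pd) (Fin d), ∀ Z : 𝔸,
      ‖(τ : 𝔸 →ₗ[ℂ] ℂ) (Z * (((plaqU Tsh (Ucur U₀) q.2.1 q.2.2 q.1)⁻¹ : 𝔸ˣ) : 𝔸))‖ ≤ ‖Z‖)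
    (Y : Space115 L η lev₀ lev₁ Dc) (hY : ‖Y‖ < 1 / 16) :
    ‖curV0prime (lev₁ := lev₁) (Dc := Dc) ρ τ U₀ Y‖
      ≤ (1024 * ((d - 1 : ℕ) : ℝ) * Λ ^ 3 * ‖ρ‖ * (K + 1 / 16)) * ‖Y‖ ^ 2 := by
  set C₀ : ℝ := 1024 * ((d - 1 : ℕ) : ℝ) * Λ ^ 3 * ‖ρ‖ with hC₀
  have hC₀0 : 0 ≤ C₀ := by positivity
  -- for every `ε₃ ∈ (‖Y‖, 1/16]`: `‖cur Y‖ ≤ C₀ (K + 1/16) ε₃²`; let `ε₃ ↓ ‖Y‖`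
  have h97 : ∀ ε₃ : ℝ, ‖Y‖ < ε₃ → ε₃ ≤ 1 / 16 →
      ‖curV0prime (lev₁ := lev₁) (Dc := Dc) ρ τ U₀ Y‖ ≤ C₀ * (K + 1 / 16) * ε₃ ^ 2 := by
    intro ε₃ h1 h2
    have hε₃ : 0 < ε₃ := (norm_nonneg Y).trans_lt h1
    have h := norm_curV0prime_le (lev₁ := lev₁) (Dc := Dc) ρ τ U₀ hU hUn hτ hτs hL hK hε₃ h2 hΛ0 hΛ hRe1 hIm hW hW' Y h1
    refine h.trans ?_
    have : ε₃ ^ 2 * (K + ε₃) ≤ (K + 1 / 16) * ε₃ ^ 2 := by nlinarith [sq_nonneg ε₃]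
    calc C₀ * (ε₃ ^ 2 * (K + ε₃)) ≤ C₀ * ((K + 1 / 16) * ε₃ ^ 2) := mul_le_mul_of_nonneg_left this hC₀0
      _ = C₀ * (K + 1 / 16) * ε₃ ^ 2 := by ring
  -- continuity from the right of `ε₃ ↦ c ε₃²`
  have hcont : Tendsto (fun t : ℝ => C₀ * (K + 1 / 16) * t ^ 2) (𝓝[>] ‖Y‖) (𝓝 (C₀ * (K + 1 / 16) * ‖Y‖ ^ 2)) :=
    ((continuous_const.mul (continuous_pow 2)).tendsto ‖Y‖).mono_left nhdsWithin_le_nhds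
  have hmem : ∀ᶠ t in 𝓝[>] ‖Y‖, ‖Y‖ < t ∧ t ≤ 1 / 16 := by
    have h1 : ∀ᶠ t in 𝓝[>] ‖Y‖, ‖Y‖ < t := eventually_nhdsWithin_of_forall fun t ht => ht
    have h2 : ∀ᶠ t in 𝓝[>] ‖Y‖, t ≤ 1 / 16 :=
      (eventually_le_nhds hY).filter_mono nhdsWithin_le_nhds |>.mono fun t ht => ht
    exact h1.and h2
  exact ge_of_tendsto hcont (hmem.mono fun t ht => h97 t ht.1 ht.2)

end Carrier

end Literature.MathematicalPhysics.QuantumFieldTheory.Balaban1983to89.B11Eq90V0primeCurrent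

end
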